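import Mathlib
import HarnessLib
import HarnessLib.Audit
import Summits.Schanuel.Statement
import Literature.NumberTheory.Transcendental.ExpVarieties

/-!
Route: ModulusFirst

CLOSED (retired) 2026-08-15T13:51:24Z by operator:999:1257524 — reason: not-a-thesis: assembly does not conclude the sub-problem Statement — note: D-0027 §2.1 audit (human 2026-08-15: routes that do not decide the summit are removed): the assembly concludes `FinitenessTwo`, not the sub-problem statement; a NEW conforming route may be opened from the same idea (generated `closes : … → _root_.Schanuel`).. The file is kept as the record of this route; refuted decls are indexed as negative knowledge (`ledger negatives`).

# Route ModulusFirst — modulus first — Khovanskii components + Schwarz reflection confine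
exponential points of a curve to one unitary axis; SC(2)-finiteness = the circle case

Realises card modulus-first-certification (keeper of the retired duplicate
exp-points-on-curves-finiteness), with the
correctness restriction found by refuter-triage-3 built in. Split the graph condition y = e^x on G₂
= ℂ² × (ℂˣ)² into
MODULUS |y_i| = e^{Re x_i} (globally tame: no periodic function) and ARGUMENT. For an irreducible
algebraic curve
W ⊂ G₂ the modulus-coincidence set M_W = {p ∈ W : |y_i| = e^{Re x_i}} is the real zero set of an
exp-polynomial
system, so by Khovanskii's component theorem (PROVED in tree, uniformly in the coefficients:
`Literature.ModelTheory.ExponentialFields.Khovanskii.exists_forall_encard_components_zeroSetR_le`)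
it has ≤ N(deg)
connected components; exponential points W ∩ Γ₂ lie in M_W. X = FinitenessTwo: every non-degenerate
irreducible
ℚ̄-curve W (x-projection not inside a translate of a rational line) carries only finitely many
points (x, e^x) with x
ℚ-linearly independent — the FINITENESS half of SC(2). Route to X: (ModulusArcDichotomy) an arc of
modulus
coincidences forces W degenerate or invariant under an anti-holomorphic involution τ_c(x,y) = (c −
x̄, e^c/ȳ),
c ∈ ℝ² (Schwarz reflection in the coordinate x₁ − log y₁ + "e^A = B in a function field ⇒
constants");
(OffAxisFiniteness) for a τ_c-symmetric non-degenerate curve all but finitely many exponential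
points lie on the real
form Re x = c/2 (the axis is unique; Khovanskii counts the rest); (SymmetricAlgebraicIsUnitary,
support) for
ℚ̄-curves c = 0 by Hermite–Lindemann + Baker; so everything reduces to (UnitaryAxisFiniteness, rank
2) — finitely
many ℚ-independent t ∈ ℝ² with (it, e^{it}) on a unitary-symmetric ℚ̄-curve: the circle/Shapiro-type
residue.
HONEST CEILING: this is a rung route. X is the finiteness half of SC(2) (it feeds route RigidCore's
rank-5 crux
SparsityTwo, stmt-Schanuel-0971, via the support glue FinitenessTwoFeedsSparsityTwo); emptiness
(SchanuelTwo,
stmt-Schanuel-0069) and n ≥ 3 are untouched and not claimed. Unconditional deliverables: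
ModulusArcDichotomy,
OffAxisFiniteness, NonSymmetricUniformBound (≤ N(d) exponential points on every non-degenerate
non-symmetric
complex curve cut out in degree ≤ d).
Lean: `∀ (W : Set (Fin 2 ⊕ Fin 2 → ℂ)), Literature.NumberTheory.Transcendental.IsIrreducibleClosed ℂ
W → Literature.NumberTheory.Transcendental.zariskiDim ℂ W = 1 →
Literature.NumberTheory.Transcendental.IsDefinedOver (algebraicClosure ℚ ℂ).toSubfield W → ¬ (∃ q :
Fin 2 → ℤ, q ≠ 0 ∧ ∃ κ : ℂ, ∀ p ∈ W, ∑ i, (q i : ℂ) * p (Sum.inl i) = κ) → Set.Finite {x : Fin 2 → ℂ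
| LinearIndependent ℚ x ∧ Sum.elim x (Complex.exp ∘ x) ∈ W}`

## Assembly
Pure logic plus two one-line facts (‖e^z‖ = e^{Re z}; x ↦ (x, e^x) is injective). Fix a
non-degenerate irreducible
ℚ̄-curve W. If W is τ_c-symmetric for some real c, SymmetricAlgebraicIsUnitary gives c = 0; the
ℚ-independent
exponential points split into those with some Re x_i ≠ 0 (finite by OffAxisFiniteness at c = 0) and
those with
x = it, t ∈ ℝ² (t inherits ℚ-independence; finite by UnitaryAxisFiniteness). If W is symmetric for
no c, the
contrapositive of ModulusArcDichotomy (W is not degenerate either) says M_W has no non-trivial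
preconnected subset,
DisconnectedModulusSetFinite makes M_W finite, and every exponential point lies in M_W.

Rationale: WHY THIS LINE. The modulus half of "y = e^x" is definable in ℝ_exp with no bound on imaginary parts,
so on a curve (real surface) the
two modulus conditions cut out a set whose topology Khovanskii's fewnomial theory controls uniformly
(Khovanskii1991
Ch. III; in tree and sorry-free: KhovanskiiSingularComponents.lean), while the arguments carry all
the arithmetic —
"first match the sizes, then the angles". Prior uses of exactly this split run in the EXISTENCE
direction (Zilber2002;
Gallinaro2022 §6 Prop. 6.1–6.2, Lemma 6.3, Remark 6.4: exp(L)·S₁ⁿ = Log⁻¹(Re L), S¹-blurring,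
Khovanskii to produce
solutions); here it runs in the FINITENESS direction for the overdetermined intersection curve ∩ Γ₂,
and the only
obstruction to finiteness-by-topology — an arc of modulus coincidences — is classified by a
Schwarz-reflection argument
(complex analysis on the function field of W: reflection across the arc in the coordinate L₁ = x₁ −
log y₁ acts on
ℂ(W) because every rational function is algebraic over ℂ(dL₂/dL₁), and e^A = B with A, B algebraic
over ℂ(W) forces
constants). Imported areas: real fewnomial/o-minimal geometry (component bounds), reflection
principle / harmonic zero
sets, and — only at linear strength, in support items — Hermite–Lindemann and Baker (tree:
transcendental_exp_holds,
baker_holds). What it does that prior routes do not: RigidCore wants SparsityTwo whole (open: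
Shapiro-type atoms);
this line proves the geometric part unconditionally, isolates the arithmetic residue as ONE crisply
typed statement
about unitary points (it, e^{it}), t ∈ ℝ², on unitary-symmetric ℚ̄-curves (= the a = 0 "circle"
sector of card
conjugation-descent-pfaffian, the atoms of cards pell-orbit-analyticity-shapiro /
dirichlet-atom-census), and makes
the card's certified per-curve exclusion terminate exactly off that class. Negatives index: empty at
filing.

RANKED CRUXES. #0 FinitenessTwo (target) — every geometrically irreducible algebraic curve W ⊂ ℂ² ×
ℂ² defined over ℚ̄ whose x-projection is not contained in a translate of a rational line carries
only finitely many exponential points (x, e^x) with x ℚ-linearly independent (finiteness half of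
SC(2); SC(2) predicts none). (why it might fail: contains the unitary-axis residue (crux
UnitaryAxisFiniteness): Shapiro/Jossen-type finiteness for coprime exponential polynomials over ℚ̄,
known only under SC (arXiv:2503.20345 Thm 1.7) or in special cases.) [arXiv:2503.20345,
DaquinoMacintyreTerzo2014, Zilber2002, MantovaZannier2016]
#2 UnitaryAxisFiniteness (crux) — for a geometrically irreducible ℚ̄-curve W ⊂ ℂ² × ℂ²,
non-degenerate and unitary-symmetric (invariant under τ₀(x,y) = (−x̄, 1/ȳ) on y ≠ 0), the set of t ∈
ℝ² with t ℚ-linearly independent and (it₁, it₂, e^{it₁}, e^{it₂}) ∈ W is finite — the circle/Shapiro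
residue of SC(2)-finiteness (card item: symmetric sub-census). [difficulty: open-problem] (why it
might fail: open even for W={x₂=αx₁, y_j Möbius}: common zeros of (1−t)e^t−(1+t), (2−t)e^{αt}−(2+t)
are Jossen/Shapiro-type, known only under SC (arXiv:2503.20345 Thm 1.7) or for quadratic α with
torsion phases; near-coincidences are 1/k-dense (Kronecker).) [arXiv:2503.20345,
DaquinoMacintyreTerzo2014, arXiv:1206.6747, BakerTNT1975]
#3 ModulusArcDichotomy (crux) — if W ⊂ ℂ² × ℂ² is a geometrically irreducible algebraic curve and
the modulus-coincidence set M_W = {p ∈ W : |y_i| = e^{Re x_i}, i = 1,2} contains a non-trivial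
preconnected subset, then either the x-projection of W lies in a translate of a rational line
(degenerate) or W is invariant under some τ_c(x, y) = (c − x̄, e^{c}/ȳ), c ∈ ℝ² (the repaired LEMMA
of the card: Schwarz reflection across the arc in the coordinate x₁ − log y₁; dL₂/dL₁ constant gives
the degenerate/constant-y branch, non-constant makes the reflection act on ℂ(W) and e^A = B forces
the affine anti-holomorphic form). [difficulty: L] (why it might fail: the first version of this
lemma was FALSE (refuter-triage-3: unitary-symmetric curves); a third family — an arc through
singular points/punctures, or a reflection that is not single-valued on ℂ(W) — would break it again,
and with it every unconditional item below.) [Gallinaro2022, Zilber2002, Khovanskii1991, Marker2006]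
#4 OffAxisFiniteness (crux) — if W is a non-degenerate geometrically irreducible curve invariant
under τ_c for some c ∈ ℝ², then only finitely many exponential points (x, e^x) ∈ W have Re x ≠ c/2
in some coordinate: all but finitely many exponential points lie on the real form Fix(τ_c) ∩ Γ₂ =
{Re x = c/2} (uniqueness of the axis: two reflections compose to a real translation-dilation that no
non-degenerate curve admits; then Khovanskii's component bound makes the off-axis part of M_W a
finite set of isolated points). [deps: ModulusArcDichotomy] [difficulty: L] (why it might fail:
needs UNIQUENESS of the symmetry axis for non-degenerate curves and that every non-trivial component
of M_W lies inside Fix(τ_c); a curve symmetric under two τ_c's, or an arc of M_W leaving the axis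
through a singular point, refutes it as stated.) [Khovanskii1991, Wilkie1996, Gallinaro2022]
#9 DisconnectedModulusSetFinite (support) — for any Zariski-closed W ⊂ ℂ² × ℂ², if the
modulus-coincidence set M_W has no non-trivial preconnected subset then it is finite — transfer of
the PROVED tree theorem Khovanskii.exists_forall_encard_components_zeroSetR_le (real and imaginary
parts of generators of I(W) and |y_i|² − exp(2 Re x_i) are L_exp-terms; finitely many components,
each a singleton). [difficulty: provable-now] [Khovanskii1991, Wilkie1996,
Literature.ModelTheory.ExponentialFields.Khovanskii.exists_forall_encard_components_zeroSetR_le]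
#9 SymmetricAlgebraicIsUnitary (support) — a non-degenerate geometrically irreducible ℚ̄-curve
meeting the torus {y₁y₂ ≠ 0} and invariant under τ_c (c ∈ ℝ²) on that part has c = 0: the set of (a,
b) with (x, y) ↦ (a − x, b/y) mapping W̄ into W is a ℚ̄-definable coset of the translation-dilation
stabiliser of W; finite stabiliser ⇒ (c, e^c) algebraic ⇒ c = 0 by Hermite–Lindemann (tree
transcendental_exp_holds); infinite stabiliser ⇒ W = {y = β} × (line of real irrational algebraic
slope α) and 2Re κ = log|β₂|² − α log|β₁|² ⇒ |β| = 1, c = 0 by Baker (tree baker_holds).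
[difficulty: M] [BakerTNT1975, Lindemann1882, Literature.NumberTheory.Transcendental.baker_holds,
Literature.NumberTheory.Transcendental.transcendental_exp_holds]
#9 NonSymmetricUniformBound (support) — the card's (F) in quantitative form: for every d there is
N(d) such that every non-degenerate, non-symmetric geometrically irreducible curve W ⊂ ℂ² × ℂ² cut
out by polynomials of total degree ≤ d carries at most N(d) exponential points (Khovanskii's bound
is uniform in the coefficients; with ModulusArcDichotomy the modulus set is totally disconnected, so
each exponential point is a component). [difficulty: M] [Khovanskii1991, Khovanskii1984,
Literature.ModelTheory.ExponentialFields.Khovanskii.exists_forall_encard_components_zeroSetR_le]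
#9 FinitenessTwoFeedsSparsityTwo (support) — glue to route RigidCore: FinitenessTwo implies
SparsityTwo (stmt-Schanuel-0971, signature verbatim) — decompose a ℚ-closed W with zariskiDim < 2
into ℚ̄-points and geometrically irreducible ℚ̄-curves; degenerate components carry no ℚ-independent
exponential point off a finite set (q·x = κ ∈ ℚ̄ and y^q = e^κ: either a proper closed condition on
the curve, or e^κ = μ ∈ ℚ̄ forces κ = 0 by Hermite–Lindemann, i.e. x dependent). [difficulty: M]
[Lindemann1882, Kirby2010, Literature.NumberTheory.Transcendental.transcendental_exp_holds]

TWO-LAYER PLAN. Foreseen glued splits (none filed now): ModulusArcDichotomy ⇐ LocalReflection (an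
arc of M_W through a smooth point
where x₁ − log y₁ is a coordinate yields an anti-holomorphic involution ρ of a neighbourhood with
L_i∘ρ = −L̄_i and
conj∘(h∘ρ) algebraic over ℂ(dL₂/dL₁) for every h ∈ ℂ(W)) → ExpConstancy (e^A = B with A, B in a
finite extension of
ℂ(W) ⇒ A, B constant) → ModulusArcDichotomy. OffAxisFiniteness ⇐ UniqueAxis (τ_c, τ_{c'} both
preserve a
non-degenerate curve ⇒ c = c') → ArcsOnAxis (every non-trivial component of M_W ⊂ Fix(τ_c)) →
OffAxisFiniteness.
UnitaryAxisFiniteness ⇐ LinearAxisQuadraticSlope (x-projection a line of real-quadratic slope,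
torsion phases:
card pell-orbit-analyticity-shapiro Theorem P) → LinearAxisAtoms (slope of degree ≥ 3 / non-torsion
phases) →
NonlinearAxis (x-projection of degree ≥ 2) — k = 3.

KILL CRITERIA. ModulusArcDichotomy refuted (a non-degenerate curve, symmetric under no τ_c, whose
modulus set contains an arc):
the mechanism is dead — close `refuted:ModulusArcDichotomy` (F' then has no topological proof).
OffAxisFiniteness
refuted (two symmetry axes / off-axis accumulation on a non-degenerate curve): pivot by restating
with "finitely many
axes" if the witness allows, else close. UnitaryAxisFiniteness or FinitenessTwo refuted = infinitely
many
ℚ-independent exponential points on one ℚ̄-curve = ¬SC(2): refutes `Schanuel`, closes every route of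
the summit.
SparsityTwo (stmt-Schanuel-0971) proved elsewhere moots the target and rank-2 crux but not cruxes
3–4 and the uniform
bound, which stand as unconditional theorems; SchanuelTwo (stmt-Schanuel-0069) proved moots the
whole route.

NOT DECOMPOSED YET. The explicit value of N(d) (Khovanskii1991 Ch. III §3.14 shape; the tree theorem
gives existence) — layer 2 under
NonSymmetricUniformBound. The card's certification programme (C): interval-Newton/Krawczyk
enclosures of M_W for
non-symmetric ℚ̄-curves of degree ≤ 3 and small height, each yielding a certificate "this curve
carries no exponential
point" or a flagged near-coincidence — a kit job for refuters/idle provers whose outputs attach as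
`computations`
evidence to FinitenessTwo and to EclCore's NotSchanuel item (stmt-Schanuel-0071); it provably
terminates exactly off
the unitary-symmetric class. The symmetric census (continued-fraction enumeration of
near-resonances, card
dirichlet-atom-census) is evidence for UnitaryAxisFiniteness, not an item. Root separation at
transcendental points
(Gabrielov–Vorobjov give multiplicity, not separation; audit-2 flag). n ≥ 3 (modulus set of real
dimension n − 2:
sparsity only — card sparse-sheets-wilkie-counting). Emptiness (SchanuelTwo) is another route's
business.

CHEAPEST FALSIFIER. A paper-or-kit search for a counterexample to ModulusArcDichotomy among
low-degree curves: take W = {y₁ = R₁(x₁),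
y₂ = R₂(x₁), P(x₁, x₂) = 0} with random rational Möbius R_j and P of bidegree ≤ 2, solve the two
real equations
log|R_j| = Re x_j on the real surface W numerically and test whether any 1-dimensional solution
family survives on a
curve that is neither degenerate nor τ_c-invariant (τ_c-invariance is a finite symbolic check). Done
by hand this
session on three families — {y = β} × {x₂ = αx₁ + κ} (arc iff symmetric, c_i = 2 log|β_i|), x₂ = x₁²
with |y₁| = 1
on Re x₁ = 0 (no arc: y₂(z)·conj(y₂(−z̄)) would equal e^{2z²}), and the refuter's Möbius example
(symmetric, c = 0):
all consistent. Second: a literature check whether "W ∩ Γ₂ finite off a real form" is already in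
Zilber2002 §§3–5 or
Kirby–Zilber arXiv:1108.1075 (then grade known, items stand).

NUMBERS. Khovanskii's bound for a real exp-polynomial system in k variables with q distinct
exponentials and degrees ≤ d is of
shape 2^{q(q−1)/2}(d+1)^{O(k)} (Khovanskii1991 §1.1, Ch. III); here k = 8 real variables, q = 2
exponentials
(e^{2Re x₁}, e^{2Re x₂}). Known unconditional pieces of UnitaryAxisFiniteness: x-projection a line
of real-quadratic
slope with torsion phases (card pell-orbit-analyticity-shapiro, Theorem P, refuter-checked
2026-08-15); finite
y-projection (RigidCore support TwoLogsBranchRelationFinite, Baker); two ℚ-independent algebraic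
slopes never occur at
n = 2. Conditional: all of it under SC (arXiv:2503.20345 Thm 1.7; DaquinoMacintyreTerzo2014 §5).
Items at open: 9.

DEFINITION REQUESTS. None filed: the modulus set, "degenerate" (x-projection in a translate of a
rational line) and the involutions τ_c are
inlined set-builders over Mathlib + Literature.NumberTheory.Transcendental.ExpVarieties
(IsIrreducibleClosed,
zariskiDim, IsDefinedOver — all companion facts discharged). If provers want names, a definition
item
`modulusSet` / `IsModulusSymmetric` under Summits/Schanuel/Schanuel/Theorems can supersede the
inlined forms later.

Novelty: Searches (2026-08-15): `lit search --source zbmath "exponential polynomial common zeros Shapiro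
conjecture"` (5: doi:10.4171/cmh/328 = arXiv:1206.6747, Abbas–Hajj-Diab zbl:1248.11057,
zbl:1276.12001, …); `lit search --source zbmath "algebraic points graph exponential function
finiteness o-minimal curve"` (0); `lit search --source zbmath "Schwarz reflection modulus
exponential algebraic curve harmonic"` (0); `lit search --source arxiv …` (HTTP 429); `lit galaxy
search "graph of the exponential function in finitely many points" --star all` (0 rows); `lit galaxy
search --star pdf --mode bm25 "finiteness of solutions of a system of two exponential-algebraic
equations … graph of exponentiation"` (15 rows: D'Aquino–Macintyre–Terzo Schanuel Nullstellensatz,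
D'Aquino–Fornasiero–Terzo TAMS 370 (2018) — existence side only); `lit read arXiv:1206.6747` p.3
(Shapiro statement; van der Poorten–Tijdeman simple case), `lit read arXiv:2503.20345` p.4 Thm 1.7,
`lit read arXiv:2203.13767` p.14 §6; local searchd DOWN (connection reset ×2); plus the card's and
refuter-triage-3's logged searches (2301.09883, 2604.15189, Kirby2010 Prop 7.2) and the retired
duplicate's (MantovaZannier2016 Thm 1.3, Zilber2002).
Nearest prior art found: Gallinaro2022 (arXiv:2203.13767 §6 Prop 6.1–6.2, Lemma 6.3, Remark 6.4: the
modulus half exp(L)·S₁ⁿ = Log⁻¹(Re L) + Khovanskii, used to PRODUCE intersections of L × W with Γ)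
and Zilber2002 (Khovanskii + transcendence for exponential sums; uniform SC as structure); fo  [refs: 10.4171/cmh/328, 1206.6747, 2503.20345, 2203.13767, doi:10.4171/cmh/328, Kirby2010, MantovaZannier2016, Zilber2002, Gallinaro2022, DaquinoMacintyreTerzo2014]

Barriers (technique_class: fewnomials, schwarz-reflection, certified-numerics): - technique_class: fewnomials, schwarz-reflection, certified-numerics
- Literature.Barriers.Schanuel.AxSchanuelFunctionalNotNumerical: accepted, not evaded — the
topological/functional input (Khovanskii components, reflection) yields FINITENESS and structure
(cruxes 3–4, uniform bound), never emptiness; the numerical content of SC(2) is quarantined in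
UnitaryAxisFiniteness and in the per-curve certificates, exactly as the barrier's moral predicts.
- Literature.Barriers.Schanuel.AlgebraicIndependenceOfLogarithms: Baker/Hermite–Lindemann enter only
at their proved LINEAR strength (support SymmetricAlgebraicIsUnitary: c = 0; glue: degenerate
components) via tree facts baker_holds / transcendental_exp_holds; no algebraic independence of
logarithms is claimed or needed.
- Literature.Barriers.Schanuel.SchanuelPropertyNotFirstOrder: consistent — every item is a statement
about the one structure (ℂ, exp, |·|, conj) using the archimedean modulus and the standard kernel;
no first-order axiomatisation or transfer of SP.
- Literature.Barriers.Schanuel.AxiomsDoNotForceSchanuel: n/a — no Zilber axioms, categoricity or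
quasiminimality used.
- Literature.Barriers.Schanuel.LinearSubgroupMethodLimit: n/a — no linear subgroup theorem /
matrices of logarithms.
- Literature.Barriers.Schanuel.LargeTranscendenceDegree,
Literature.Barriers.Schanuel.NesterenkoModularScope,
Literature.Barriers.Schanuel.EFunctionValuesAtAlgebraicPoints,
Literature.Barriers.Schanuel.PeriodConjectureOverQbarScope: other

History (route lifecycle, newest last):
- 2026-08-15T13:51:24Z · CLOSED retired — not-a-thesis: assembly does not conclude the sub-problem Statement (operator:999:1257524)

sub-problem: Schanuel · status: closed(retired) · opened planner-plancard-Schanuel-Schanuel-modulus-fi-e5261219-0 2026-08-15T11:28:26Z · rev 0 · ledger route-Schanuel-ModulusFirst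
GENERATED by the gate from the ledger (D-0016/17). Provers cite these decls: `theorem foo : Summit.Schanuel.Schanuel.Theses.ModulusFirst.<Decl> := …` in Summits/Schanuel/Schanuel/Theorems/<Name>.lean.
-/

namespace Summit.Schanuel.Schanuel.Theses.ModulusFirst

open scoped BigOperators Topology Manifold Classical MeasureTheory ProbabilityTheory Matrix InnerProductSpace ComplexConjugate ContinuousMap
open Filter Set Function TopologicalSpace MeasureTheory

attribute [summit_statement] _root_.Schanuel

open Literature.Periods

/-- item stmt-Schanuel-4146 · target · rank 0 · closed · moot by None · by planner
why it might fail: contains the unitary-axis residue (crux UnitaryAxisFiniteness): Shapiro/Jossen-type finiteness for coprime exponential polynomials over ℚ̄, known only under SC (arXiv:2503.20345 Thm 1.7) or in special cases.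
sources: arXiv:2503.20345, DaquinoMacintyreTerzo2014, Zilber2002, MantovaZannier2016
[target] every geometrically irreducible algebraic curve W ⊂ ℂ² × ℂ² defined over ℚ̄ whose
x-projection is not contained in a translate of a rational line carries only finitely many
exponential points (x, e^x) with x ℚ-linearly independent (finiteness half of SC(2); SC(2) predicts
none). -/
@[route_item "route-Schanuel-ModulusFirst"]
def FinitenessTwo : Prop :=
  ∀ (W : Set (Fin 2 ⊕ Fin 2 → ℂ)), Literature.NumberTheory.Transcendental.IsIrreducibleClosed ℂ W → Literature.NumberTheory.Transcendental.zariskiDim ℂ W = 1 → Literature.NumberTheory.Transcendental.IsDefinedOver (algebraicClosure ℚ ℂ).toSubfield W → ¬ (∃ q : Fin 2 → ℤ, q ≠ 0 ∧ ∃ κ : ℂ, ∀ p ∈ W, ∑ i, (q i : ℂ) * p (Sum.inl i) = κ) → Set.Finite {x : Fin 2 → ℂ | LinearIndependent ℚ x ∧ Sum.elim x (Complex.exp ∘ x) ∈ W}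

/-- item stmt-Schanuel-4147 · crux · rank 2 · closed · moot by None · by planner
why it might fail: open even for W={x₂=αx₁, y_j Möbius}: common zeros of (1−t)e^t−(1+t), (2−t)e^{αt}−(2+t) are Jossen/Shapiro-type, known only under SC (arXiv:2503.20345 Thm 1.7) or for quadratic α with torsion phases; near-coincidences are 1/k-dense (Kronecker).
sources: arXiv:2503.20345, DaquinoMacintyreTerzo2014, arXiv:1206.6747, BakerTNT1975
[crux] for a geometrically irreducible ℚ̄-curve W ⊂ ℂ² × ℂ², non-degenerate and unitary-symmetric
(invariant under τ₀(x,y) = (−x̄, 1/ȳ) on y ≠ 0), the set of t ∈ ℝ² with t ℚ-linearly independent and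
(it₁, it₂, e^{it₁}, e^{it₂}) ∈ W is finite — the circle/Shapiro residue of SC(2)-finiteness (card
item: symmetric sub-census). [difficulty: open-problem] -/
@[route_item "route-Schanuel-ModulusFirst"]
def UnitaryAxisFiniteness : Prop :=
  ∀ (W : Set (Fin 2 ⊕ Fin 2 → ℂ)), Literature.NumberTheory.Transcendental.IsIrreducibleClosed ℂ W → Literature.NumberTheory.Transcendental.zariskiDim ℂ W = 1 → Literature.NumberTheory.Transcendental.IsDefinedOver (algebraicClosure ℚ ℂ).toSubfield W → ¬ (∃ q : Fin 2 → ℤ, q ≠ 0 ∧ ∃ κ : ℂ, ∀ p ∈ W, ∑ i, (q i : ℂ) * p (Sum.inl i) = κ) → (∀ p ∈ W, (∀ i, p (Sum.inr i) ≠ 0) → Sum.elim (fun i => -(starRingEnd ℂ) (p (Sum.inl i))) (fun i => ((starRingEnd ℂ) (p (Sum.inr i)))⁻¹) ∈ W) → Set.Finite {t : Fin 2 → ℝ | LinearIndependent ℚ t ∧ Sum.elim (fun i => (t i : ℂ) * Complex.I) (fun i => Complex.exp ((t i : ℂ) * Complex.I)) ∈ W}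

/-- item stmt-Schanuel-4148 · crux · rank 3 · closed · moot by None · by planner
why it might fail: the first version of this lemma was FALSE (refuter-triage-3: unitary-symmetric curves); a third family — an arc through singular points/punctures, or a reflection that is not single-valued on ℂ(W) — would break it again, and with it every unconditional item below.
sources: Gallinaro2022, Zilber2002, Khovanskii1991, Marker2006
[crux] if W ⊂ ℂ² × ℂ² is a geometrically irreducible algebraic curve and the modulus-coincidence set
M_W = {p ∈ W : |y_i| = e^{Re x_i}, i = 1,2} contains a non-trivial preconnected subset, then either
the x-projection of W lies in a translate of a rational line (degenerate) or W is invariant under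
some τ_c(x, y) = (c − x̄, e^{c}/ȳ), c ∈ ℝ² (the repaired LEMMA of the card: Schwarz reflection
across the arc in the coordinate x₁ − log y₁; dL₂/dL₁ constant gives the degenerate/constant-y
branch, non-constant makes the reflection act on ℂ(W) and e^A = B forces the affine anti-holomorphic
form). [difficulty: L] -/
@[route_item "route-Schanuel-ModulusFirst"]
def ModulusArcDichotomy : Prop :=
  ∀ (W : Set (Fin 2 ⊕ Fin 2 → ℂ)), Literature.NumberTheory.Transcendental.IsIrreducibleClosed ℂ W → Literature.NumberTheory.Transcendental.zariskiDim ℂ W = 1 → (∃ C ⊆ {p : Fin 2 ⊕ Fin 2 → ℂ | p ∈ W ∧ ∀ i, ‖p (Sum.inr i)‖ = Real.exp (p (Sum.inl i)).re}, IsPreconnected C ∧ C.Nontrivial) → (∃ q : Fin 2 → ℤ, q ≠ 0 ∧ ∃ κ : ℂ, ∀ p ∈ W, ∑ i, (q i : ℂ) * p (Sum.inl i) = κ) ∨ (∃ c : Fin 2 → ℝ, ∀ p ∈ W, (∀ i, p (Sum.inr i) ≠ 0) → Sum.elim (fun i => ((c i : ℂ)) - (starRingEnd ℂ) (p (Sum.inl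 i))) (fun i => (Real.exp (c i) : ℂ) / (starRingEnd ℂ) (p (Sum.inr i))) ∈ W)

/-- item stmt-Schanuel-4149 · crux · rank 4 · closed · moot by None · by planner
why it might fail: needs UNIQUENESS of the symmetry axis for non-degenerate curves and that every non-trivial component of M_W lies inside Fix(τ_c); a curve symmetric under two τ_c's, or an arc of M_W leaving the axis through a singular point, refutes it as stated.
sources: Khovanskii1991, Wilkie1996, Gallinaro2022
[crux] if W is a non-degenerate geometrically irreducible curve invariant under τ_c for some c ∈ ℝ²,
then only finitely many exponential points (x, e^x) ∈ W have Re x ≠ c/2 in some coordinate: all but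
finitely many exponential points lie on the real form Fix(τ_c) ∩ Γ₂ = {Re x = c/2} (uniqueness of
the axis: two reflections compose to a real translation-dilation that no non-degenerate curve
admits; then Khovanskii's component bound makes the off-axis part of M_W a finite set of isolated
points). [deps: ModulusArcDichotomy] [difficulty: L] -/
@[route_item "route-Schanuel-ModulusFirst"]
def OffAxisFiniteness : Prop :=
  ∀ (W : Set (Fin 2 ⊕ Fin 2 → ℂ)), Literature.NumberTheory.Transcendental.IsIrreducibleClosed ℂ W → Literature.NumberTheory.Transcendental.zariskiDim ℂ W = 1 → ¬ (∃ q : Fin 2 → ℤ, q ≠ 0 ∧ ∃ κ : ℂ, ∀ p ∈ W, ∑ i, (q i : ℂ) * p (Sum.inl i) = κ) → ∀ c : Fin 2 → ℝ, (∀ p ∈ W, (∀ i, p (Sum.inr i) ≠ 0) → Sum.elim (fun i => ((c i : ℂ)) - (starRingEnd ℂ) (p (Sum.inl i))) (fun i => (Real.exp (c i) : ℂ) / (starRingEnd ℂ) (p (Sum.inr i))) ∈ W) → Set.Finite {x : Fin 2 → ℂ | Sum.elim x (Complex.exp ∘ x) ∈ W ∧ ∃ i, (x i).re ≠ c i / 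2}

/-- item stmt-Schanuel-4150 · support · rank 9 · closed · moot by None · by planner
sources: Khovanskii1991, Wilkie1996, Literature.ModelTheory.ExponentialFields.Khovanskii.exists_forall_encard_components_zeroSetR_le
[support] for any Zariski-closed W ⊂ ℂ² × ℂ², if the modulus-coincidence set M_W has no non-trivial
preconnected subset then it is finite — transfer of the PROVED tree theorem
Khovanskii.exists_forall_encard_components_zeroSetR_le (real and imaginary parts of generators of
I(W) and |y_i|² − exp(2 Re x_i) are L_exp-terms; finitely many components, each a singleton).
[difficulty: provable-now] -/
@[route_item "route-Schanuel-ModulusFirst"]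
def DisconnectedModulusSetFinite : Prop :=
  ∀ (W : Set (Fin 2 ⊕ Fin 2 → ℂ)), Literature.NumberTheory.Transcendental.IsZariskiClosed ℂ W → (∀ C ⊆ {p : Fin 2 ⊕ Fin 2 → ℂ | p ∈ W ∧ ∀ i, ‖p (Sum.inr i)‖ = Real.exp (p (Sum.inl i)).re}, IsPreconnected C → C.Subsingleton) → Set.Finite {p : Fin 2 ⊕ Fin 2 → ℂ | p ∈ W ∧ ∀ i, ‖p (Sum.inr i)‖ = Real.exp (p (Sum.inl i)).re}

/-- item stmt-Schanuel-4151 · support · rank 9 · closed · moot by None · by planner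
sources: BakerTNT1975, Lindemann1882, Literature.NumberTheory.Transcendental.baker_holds, Literature.NumberTheory.Transcendental.transcendental_exp_holds
[support] a non-degenerate geometrically irreducible ℚ̄-curve meeting the torus {y₁y₂ ≠ 0} and
invariant under τ_c (c ∈ ℝ²) on that part has c = 0: the set of (a, b) with (x, y) ↦ (a − x, b/y)
mapping W̄ into W is a ℚ̄-definable coset of the translation-dilation stabiliser of W; finite
stabiliser ⇒ (c, e^c) algebraic ⇒ c = 0 by Hermite–Lindemann (tree transcendental_exp_holds);
infinite stabiliser ⇒ W = {y = β} × (line of real irrational algebraic slope α) and 2Re κ = log|β₂|²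
− α log|β₁|² ⇒ |β| = 1, c = 0 by Baker (tree baker_holds). [difficulty: M] -/
@[route_item "route-Schanuel-ModulusFirst"]
def SymmetricAlgebraicIsUnitary : Prop :=
  ∀ (W : Set (Fin 2 ⊕ Fin 2 → ℂ)), Literature.NumberTheory.Transcendental.IsIrreducibleClosed ℂ W → Literature.NumberTheory.Transcendental.zariskiDim ℂ W = 1 → Literature.NumberTheory.Transcendental.IsDefinedOver (algebraicClosure ℚ ℂ).toSubfield W → ¬ (∃ q : Fin 2 → ℤ, q ≠ 0 ∧ ∃ κ : ℂ, ∀ p ∈ W, ∑ i, (q i : ℂ) * p (Sum.inl i) = κ) → (∃ p ∈ W, ∀ i, p (Sum.inr i) ≠ 0) → ∀ c : Fin 2 → ℝ, (∀ p ∈ W, (∀ i, p (Sum.inr i) ≠ 0) → Sum.elim (fun i => ((c i : ℂ)) - (starRingEnd ℂ) (p (Sum.inl i))) (fun i => (Real.exp (c i) : ℂ) / (starRingEnd ℂ) (p (Sum.inr i))) ∈ W) → c = 0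

/-- item stmt-Schanuel-4152 · support · rank 9 · closed · moot by None · by planner
sources: Khovanskii1991, Khovanskii1984, Literature.ModelTheory.ExponentialFields.Khovanskii.exists_forall_encard_components_zeroSetR_le
[support] the card's (F) in quantitative form: for every d there is N(d) such that every
non-degenerate, non-symmetric geometrically irreducible curve W ⊂ ℂ² × ℂ² cut out by polynomials of
total degree ≤ d carries at most N(d) exponential points (Khovanskii's bound is uniform in the
coefficients; with ModulusArcDichotomy the modulus set is totally disconnected, so each exponential
point is a component). [difficulty: M] -/
@[route_item "route-Schanuel-ModulusFirst"]
def NonSymmetricUniformBound : Prop :=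
  ∀ d : ℕ, ∃ N : ℕ, ∀ (W : Set (Fin 2 ⊕ Fin 2 → ℂ)), Literature.NumberTheory.Transcendental.IsIrreducibleClosed ℂ W → Literature.NumberTheory.Transcendental.zariskiDim ℂ W = 1 → (∃ S : Finset (MvPolynomial (Fin 2 ⊕ Fin 2) ℂ), (∀ f ∈ S, f.totalDegree ≤ d) ∧ W = MvPolynomial.zeroLocus ℂ (Ideal.span (S : Set (MvPolynomial (Fin 2 ⊕ Fin 2) ℂ)))) → ¬ (∃ q : Fin 2 → ℤ, q ≠ 0 ∧ ∃ κ : ℂ, ∀ p ∈ W, ∑ i, (q i : ℂ) * p (Sum.inl i) = κ) → ¬ (∃ c : Fin 2 → ℝ, ∀ p ∈ W, (∀ i, p (Sum.inr i) ≠ 0) → Sum.elim (fun i => ((c i : ℂ)) - (starRingEnd ℂ) (p (Sum.inl i))) (fun i => (Real.exp (c i) : ℂ) / (starRingEnd ℂ) (p (Sum.inr i))) ∈ W) → {x : Fin 2 → ℂ | Sum.elim x (Complex.exp ∘ x) ∈ W}.encard ≤ N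

/-- item stmt-Schanuel-4153 · support · rank 9 · closed · moot by None · by planner
sources: Lindemann1882, Kirby2010, Literature.NumberTheory.Transcendental.transcendental_exp_holds
[support] glue to route RigidCore: FinitenessTwo implies SparsityTwo (stmt-Schanuel-0971, signature
verbatim) — decompose a ℚ-closed W with zariskiDim < 2 into ℚ̄-points and geometrically irreducible
ℚ̄-curves; degenerate components carry no ℚ-independent exponential point off a finite set (q·x = κ
∈ ℚ̄ and y^q = e^κ: either a proper closed condition on the curve, or e^κ = μ ∈ ℚ̄ forces κ = 0 by
Hermite–Lindemann, i.e. x dependent). [difficulty: M] -/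
@[route_item "route-Schanuel-ModulusFirst"]
def FinitenessTwoFeedsSparsityTwo : Prop :=
  FinitenessTwo → ∀ (W : Set (Fin 2 ⊕ Fin 2 → ℂ)), Literature.NumberTheory.Transcendental.IsDefinedOver (⊥ : Subfield ℂ) W → Literature.NumberTheory.Transcendental.zariskiDim ℂ W < 2 → Set.Finite {x : Fin 2 → ℂ | LinearIndependent ℚ x ∧ Sum.elim x (Complex.exp ∘ x) ∈ W}

/-- item stmt-Schanuel-4154 · assembly · rank 1 · closed · moot by None · by planner
sources: Kirby2010, Zilber2002
[assembly] ModulusArcDichotomy → DisconnectedModulusSetFinite → SymmetricAlgebraicIsUnitary →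
OffAxisFiniteness → UnitaryAxisFiniteness → FinitenessTwo (rung assembly; HONEST CEILING:
FinitenessTwo is the finiteness half of SC(2), linked onward to RigidCore.SparsityTwo by the support
glue, not to `Schanuel`). -/
@[route_item "route-Schanuel-ModulusFirst"]
def Assembly : Prop :=
  ModulusArcDichotomy → DisconnectedModulusSetFinite → SymmetricAlgebraicIsUnitary → OffAxisFiniteness → UnitaryAxisFiniteness → FinitenessTwo

end Summit.Schanuel.Schanuel.Theses.ModulusFirst
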